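import Summits.Ventures.GridStability.Lyapunov.GroundedLaplacianSMatCert
import HarnessLib

/-!
# The NO side of the λ-certificate: one test vector refutes `hlam` (G2-SCALE Q2, lead g19 §17 (K4))

Venture GRIDFUSION, G2-SCALE cell (lead g19 §17 (K4) «the one-test-vector lemma (λ₂ ≤ Rayleigh(v), v ⟂ 𝟙;
weights monotone) in the SMat vocabulary»; owner gridfusion-sos-5 g9; NO-side instrument = lit-3's
`q2_no_testvector.py`). The dVOC Condition-2 / droop / Kuramoto chains consume the variational hypothesis
`hlam : ∀ z, μ·pairNormSq z ≤ N·½ΣΣ aᵢⱼ(zᵢ − zⱼ)²` (`⟺ μ ≤ λ₂` of the Laplacian of the real weights `a`).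
This file is its REFUTATION format: a rational test vector `v` with `Σ v = 0` (then `pairNormSq v = N Σ vᵢ²`,
`pairNormSq_eq`) and `ΣΣ w⁺ᵢⱼ(vᵢ − vⱼ)² < 2μ Σ vᵢ²` for rational UPPER weights `w⁺ ≥ a` (the real `‖Y_l‖`
are irrational; the energy is monotone in the weights) give `¬ hlam`. In the SMat vocabulary of
`GroundedLaplacianSMatCert.lean`: `w⁺ = matrixOfSparseRows N N Wp` for ONE sparse literal `Wp : SMat ℚ`
(node ↦ (neighbour, w⁺) pairs, both directions stored), the energy is evaluated SPARSELY
(`sparseEnergy2`, `O(nnz)` terms; `laplacianEnergy2_eq_sparseEnergy2`), and the three obligations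
`colsBelow`, `Σ v = 0`, `energy < 2μΣv²` are `decide`s over `ℚ`.

CONVENTION for instance writers (lit-3 / lit-2): nodes `0 … N−1`; `Wp` row `i` = list of `(j, w⁺ᵢⱼ)` with
`w⁺ᵢⱼ = w⁺ⱼᵢ` a short decimal rational `≥ ‖Yᵢⱼ‖` (the consumer discharges `a ≤ w⁺` edgewise); `v : List ℚ`
of integers (scale-free), `Σ v = 0` EXACTLY; `μ : ℚ`. THREE COLUMNS. CERTIFIED (kernel): everything here.
VALIDATED / MODELLED: nothing. [cite: DorflerBullo2012, arXiv:0910.5673 §5.1 proof of Thm 5.1 (‖Hδ‖² = n‖δ_⊥‖²); BarrettEtAl1994, §4.3.1 «Compressed Row Storage (CRS)», p. 57]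
-/

namespace Summit.Ventures.GridStability.Lyapunov

open Finset Matrix
open Literature.MathematicalPhysics.PowerSystems
open Literature.Computation.Certificates Literature.Computation.Certificates.PSD

variable {n : ℕ}

/-- A `Fin n`-sum of an `ℕ`-indexed function is the list sum over `List.range n` (the computable side).
[folklore] -/
theorem sum_fin_eq_sum_range_map {α : Type*} [AddCommMonoid α] (f : ℕ → α) (n : ℕ) :
    ∑ i : Fin n, f i.val = ((List.range n).map f).sum := by
  rw [Fin.sum_univ_eq_sum_range, Finset.sum_eq_multiset_sum, Finset.range_val, ← Multiset.coe_range,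
    Multiset.map_coe, Multiset.sum_coe]

/-- Rows of a `colsBelow` matrix have in-range columns (also the default row past the end). [folklore] -/
theorem all_lt_of_colsBelow {W : SMat ℚ} (hW : colsBelow n W = true) (i : ℕ) :
    ((W.getD i []).all fun p => decide (p.1 < n)) = true := by
  rw [List.getD_eq_getElem?_getD]
  cases hW' : W[i]? with
  | none => rfl
  | some r =>
    rw [Option.getD_some]
    exact (List.all_eq_true.1 hW) r (List.mem_of_getElem? hW')

/-- Weighted row sum over `Fin n` of a sparse row with in-range columns, as a list computation:
`Σ_j (fn r j)·f j = Σ_{(j,w) ∈ r} w·f j`. [cite: BarrettEtAl1994, §4.3.2 «CRS Matrix-Vector Product», p. 61] -/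
theorem sum_fn_mul (r : SRow ℚ) (h : (r.all fun p => decide (p.1 < n)) = true) (f : ℕ → ℚ) :
    ∑ j : Fin n, SRow.fn r j.val * f j.val = (r.map fun p => p.2 * f p.1).sum := by
  induction r with
  | nil => simp
  | cons p r ih =>
    obtain ⟨u, w⟩ := p
    rw [List.all_cons, Bool.and_eq_true, decide_eq_true_eq] at h
    simp only [SRow.fn_cons, add_mul, Finset.sum_add_distrib, ih h.2, List.map_cons, List.sum_cons]
    congr 1
    rw [Finset.sum_eq_single ⟨u, h.1⟩
      (fun b _ hb => by rw [if_neg (fun hub => hb (Fin.ext hub.symm)), zero_mul])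
      (fun hnot => absurd (Finset.mem_univ _) hnot)]
    simp

/-- **Sparse evaluation of twice the Dirichlet energy** `ΣᵢΣ_{(j,w) ∈ W[i]} w (vᵢ − vⱼ)²` of a list vector
(`v.getD i 0`), row by row — `O(nnz)` terms. [cite: BarrettEtAl1994, §4.3.2 «CRS Matrix-Vector Product», p. 61] -/
def sparseEnergy2 (n : ℕ) (W : SMat ℚ) (v : List ℚ) : ℚ :=
  ((List.range n).map fun i =>
    ((W.getD i []).map fun p => p.2 * (v.getD i 0 - v.getD p.1 0) ^ 2).sum).sum

/-- The dense double sum `ΣᵢΣⱼ Wᵢⱼ (vᵢ − vⱼ)²` of the kernel matrix IS the sparse evaluation.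
[cite: BarrettEtAl1994, §4.3.2 «CRS Matrix-Vector Product», p. 61] -/
theorem laplacianEnergy2_eq_sparseEnergy2 (W : SMat ℚ) (hW : colsBelow n W = true) (v : List ℚ) :
    ∑ i : Fin n, ∑ j : Fin n,
        matrixOfSparseRows n n W i j * (v.getD i.val 0 - v.getD j.val 0) ^ 2
      = sparseEnergy2 n W v := by
  unfold sparseEnergy2
  rw [← sum_fin_eq_sum_range_map
    (fun i => ((W.getD i []).map fun p => p.2 * (v.getD i 0 - v.getD p.1 0) ^ 2).sum) n]
  refine Finset.sum_congr rfl fun i _ => ?_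
  simp only [matrixOfSparseRows_apply]
  exact sum_fn_mul _ (all_lt_of_colsBelow hW i.val) (fun j => (v.getD i.val 0 - v.getD j 0) ^ 2)

/-- **One test vector refutes the connectivity hypothesis.** If `Σᵢ vᵢ = 0` and
`ΣᵢΣⱼ w⁺ᵢⱼ(vᵢ − vⱼ)² < 2μ Σᵢ vᵢ²` for rational upper weights `w⁺ = matrixOfSparseRows n n Wp ≥ a`, then
`hlam : ∀ z, μ·pairNormSq z ≤ n·½ΣΣ aᵢⱼ(zᵢ − zⱼ)²` is FALSE (at `z = v`: `pairNormSq v = nΣvᵢ²` and the energy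
is monotone in the weights) — i.e. `μ > λ₂(L_a)` in the chains' variational vocabulary. The three numeric
hypotheses are `decide`s over `ℚ`. [cite: DorflerBullo2012, arXiv:0910.5673 §5.1 proof of Thm 5.1 (‖Hδ‖² = n‖δ_⊥‖²)] -/
theorem not_connectivity_certificate_of_testVector (Wp : SMat ℚ) (hW : colsBelow n Wp = true)
    (v : List ℚ) (μ : ℚ) (hsum : ((List.range n).map fun i => v.getD i 0).sum = 0)
    (htest : sparseEnergy2 n Wp v < 2 * μ * ((List.range n).map fun i => v.getD i 0 ^ 2).sum)
    (a : Fin n → Fin n → ℝ) (ha : ∀ i j, a i j ≤ ((matrixOfSparseRows n n Wp i j : ℚ) : ℝ)) :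
    ¬ ∀ z : Fin n → ℝ,
        (μ : ℝ) * pairNormSq z ≤ (n : ℝ) * (1 / 2 * ∑ i, ∑ j, a i j * (z i - z j) ^ 2) := by
  intro h
  rcases Nat.eq_zero_or_pos n with hn0 | hnpos
  · subst hn0
    simp [sparseEnergy2] at htest
  set z : Fin n → ℝ := fun i => ((v.getD i.val 0 : ℚ) : ℝ) with hz
  have h1 : (∑ i : Fin n, v.getD i.val 0 : ℚ) = 0 := by
    rw [sum_fin_eq_sum_range_map (fun i => v.getD i 0) n]; exact hsum
  have hzsum : ∑ i, z i = 0 := by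
    simp only [hz]; exact_mod_cast h1
  have h2 : (∑ i : Fin n, v.getD i.val 0 ^ 2 : ℚ) = ((List.range n).map fun i => v.getD i 0 ^ 2).sum :=
    sum_fin_eq_sum_range_map (fun i => v.getD i 0 ^ 2) n
  have hsq : ∑ i, z i ^ 2 = ((((List.range n).map fun i => v.getD i 0 ^ 2).sum : ℚ) : ℝ) := by
    rw [← h2]; simp only [hz]; push_cast; rfl
  have h3 := laplacianEnergy2_eq_sparseEnergy2 Wp hW v
  have hE : ∑ i, ∑ j, ((matrixOfSparseRows n n Wp i j : ℚ) : ℝ) * (z i - z j) ^ 2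
      = ((sparseEnergy2 n Wp v : ℚ) : ℝ) := by
    simp only [hz]; exact_mod_cast h3
  have hmono : ∑ i, ∑ j, a i j * (z i - z j) ^ 2
      ≤ ∑ i, ∑ j, ((matrixOfSparseRows n n Wp i j : ℚ) : ℝ) * (z i - z j) ^ 2 :=
    Finset.sum_le_sum fun i _ => Finset.sum_le_sum fun j _ =>
      mul_le_mul_of_nonneg_right (ha i j) (sq_nonneg _)
  have hp : pairNormSq z = (n : ℝ) * ∑ i, z i ^ 2 := by rw [pairNormSq_eq, hzsum]; ring
  have htest' : ((sparseEnergy2 n Wp v : ℚ) : ℝ) < 2 * (μ : ℝ) * ∑ i, z i ^ 2 := by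
    rw [hsq]; exact_mod_cast htest
  have hn' : (0 : ℝ) < (n : ℝ) := by exact_mod_cast hnpos
  have key := h z
  rw [hp] at key
  have c1 : (n : ℝ) * (1 / 2 * ∑ i, ∑ j, a i j * (z i - z j) ^ 2)
      ≤ (n : ℝ) * (1 / 2 * ∑ i, ∑ j, ((matrixOfSparseRows n n Wp i j : ℚ) : ℝ) * (z i - z j) ^ 2) :=
    mul_le_mul_of_nonneg_left (by linarith) hn'.le
  have c2 : (n : ℝ) * (1 / 2 * ∑ i, ∑ j, ((matrixOfSparseRows n n Wp i j : ℚ) : ℝ) * (z i - z j) ^ 2)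
      < (n : ℝ) * ((μ : ℝ) * ∑ i, z i ^ 2) :=
    mul_lt_mul_of_pos_left (by rw [hE]; linarith) hn'
  linarith

/-- **Monotonicity of the YES side in the weights**: a connectivity certificate for rational LOWER weights
`w⁻ ≤ a` (e.g. `matrixOfSparseRows N N W` of `GroundedLaplacianSMatCert`) is one for the real weights `a`
(the irrational `‖Y_l‖` of a printed feeder) — the energy is monotone in the weights. [folklore] -/
theorem connectivity_certificate_of_le_weights (w a : Fin n → Fin n → ℝ) (hle : ∀ i j, w i j ≤ a i j)
    (μ : ℝ) (h : ∀ z : Fin n → ℝ, μ * pairNormSq z ≤ (n : ℝ) * (1 / 2 * ∑ i, ∑ j, w i j * (z i - z j) ^ 2)) :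
    ∀ z : Fin n → ℝ, μ * pairNormSq z ≤ (n : ℝ) * (1 / 2 * ∑ i, ∑ j, a i j * (z i - z j) ^ 2) := by
  intro z
  refine (h z).trans (mul_le_mul_of_nonneg_left ?_ (Nat.cast_nonneg n))
  have hmono : ∑ i, ∑ j, w i j * (z i - z j) ^ 2 ≤ ∑ i, ∑ j, a i j * (z i - z j) ^ 2 :=
    Finset.sum_le_sum fun i _ => Finset.sum_le_sum fun j _ =>
      mul_le_mul_of_nonneg_right (hle i j) (sq_nonneg _)
  linarith

/-- **The connectivity hypothesis is antitone in `λ`**: a certificate at `λ` is one at every `λ' ≤ λ`. [folklore] -/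
theorem connectivity_certificate_antitone (a : Fin n → Fin n → ℝ) {lam lam' : ℝ} (hle : lam' ≤ lam)
    (h : ∀ z : Fin n → ℝ, lam * pairNormSq z ≤ (n : ℝ) * (1 / 2 * ∑ i, ∑ j, a i j * (z i - z j) ^ 2)) :
    ∀ z : Fin n → ℝ, lam' * pairNormSq z ≤ (n : ℝ) * (1 / 2 * ∑ i, ∑ j, a i j * (z i - z j) ^ 2) := by
  intro z
  have hP : 0 ≤ pairNormSq z := by
    unfold pairNormSq
    exact mul_nonneg (by norm_num) (Finset.sum_nonneg fun i _ => Finset.sum_nonneg fun j _ => sq_nonneg _)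
  exact (mul_le_mul_of_nonneg_right hle hP).trans (h z)

/-- **A NO certificate at `μ` caps every admissible constant**: if `hlam(μ)` is refuted (e.g. by
`not_connectivity_certificate_of_testVector`) then every `λ` with `hlam(λ)` satisfies `λ < μ` — the form in which a
Condition-2-type verdict consumes the NO side («the budget `λ₂` is below `μ`»). [folklore] -/
theorem lt_of_not_connectivity_certificate (a : Fin n → Fin n → ℝ) (μ : ℝ)
    (hno : ¬ ∀ z : Fin n → ℝ, μ * pairNormSq z ≤ (n : ℝ) * (1 / 2 * ∑ i, ∑ j, a i j * (z i - z j) ^ 2))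
    (lam : ℝ) (h : ∀ z : Fin n → ℝ, lam * pairNormSq z ≤ (n : ℝ) * (1 / 2 * ∑ i, ∑ j, a i j * (z i - z j) ^ 2)) :
    lam < μ := by
  by_contra hge
  push Not at hge
  exact hno (connectivity_certificate_antitone a hge h)

end Summit.Ventures.GridStability.Lyapunov
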